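import Mathlib
import HarnessLib
import Literature.MathematicalPhysics.QuantumFieldTheory.WilsonEnergyConvexity
import Summits.Ventures.LatticeQCDFlow.Scaling.AcceptanceVolumeDecayPi
import Summits.Ventures.LatticeQCDFlow.Scaling.AcceptanceEssEightNinthsDensities

/-!
# LatticeQCDFlow / Scaling — the UNTRAINED (identity-flow) exact sampler of Wilson lattice gauge
# theory for ANY compact gauge group, representation, dimension and torus size, in closed form:
# `ESS = Z(β)²/Z(2β)`, `(8/9)·Z(β)²/Z(2β) ≤ acc ≤ Z(β/2)²/Z(β)`,
# `D(μ‖Wilson) = log Z(β) + β·∫S dμ`, `D(Wilson‖μ) = −β⟨S⟩_β − log Z(β)`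

HONEST FRAMING: exact (Metropolis-corrected) sampling algorithms for lattice gauge theory;
figures of merit are autocorrelation/cost numbers at stated couplings and volumes; no
continuum-physics claim.

Venture `LatticeQCDFlow` (cell pub-lqcd), topic `Scaling`; FANOUT row 3 (`s0-u1-a`, S0-B
implementation A, GEN-13).  NEW WORK of the cell (closed forms, no numerics): the group-independent
form of row 3's identity-flow baselines (`Scaling/U1IdentityFlowVolumeLaw`, `SU2IdentityFlowVolumeLaw`,
`U1WilsonIdentityFlowLaw`).  Setting = theory-2's Wilson lattice gauge theory
(`Literature…ConstructiveQFTWave0`: compact group `G`, continuous matrix representation `ρ`, torus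
`(ℤ/L)^d`, Wilson action `S = Σ_p (N − Re tr ρ(U_p))`; integrability from `WilsonEnergyConvexity`,
imported).  The sampler proposes whole configurations i.i.d. from a reference PROBABILITY law `μ` on
`GaugeConfig d L G` (model density `q ≡ 1` w.r.t. `μ`) and Metropolis-corrects against the Boltzmann
tilt `p = e^{−βS}/Z_μ(β)`, `Z_μ(β) = ∫ e^{−βS} dμ`; for `μ = Haar^{⊗E}` this is the IDENTITY FLOW of
the cell (fresh Haar links against the Wilson law) and `Z_μ = (partitionFunction ρ ·).toReal` by the
tree's `partitionFunction_toReal_eq_integral`.  Because the action enters LINEARLY in `β`,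
`p² ∝ e^{−2βS}` and `√p ∝ e^{−(β/2)S}`, so every figure of merit is a ratio of partition functions:

* §1 `exp_neg_mul_wilsonAction_sq`, `sqrt_exp_neg_mul_wilsonAction`, `wilsonZI_pos`, `integral_wilsonD`;
* §2 **`integral_wilsonD_sq`** `∫ p² dμ = Z(2β)/Z(β)²`, **`wilsonIdentityFlow_essFrac`**
  `ESS = (∫p)²/∫p² = Z(β)²/Z(2β)`, **`integral_sqrt_wilsonD`** `BC = ∫ √p dμ = Z(β/2)/√Z(β)`,
  **`wilsonIdentityFlow_meanAccept_mem_Icc`** `(8/9)·Z(β)²/Z(2β) ≤ ∫∫ min(p(U), p(U′)) ≤ Z(β/2)²/Z(β)`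
  (row 3's general-space `acc ≥ (8/9)·ESS` law `Scaling/AcceptanceEssEightNinthsDensities` and the
  Bhattacharyya ceiling `Scaling/AcceptanceVolumeDecayPi`, imported);
* §3 **`wilsonIdentityFlow_reverseKL`** `∫ log(1/p) dμ = log Z(β) + β·∫ S dμ` (the self-training loss
  at zero training, up to its constant) and **`wilsonIdentityFlow_forwardKL`**
  `∫ p log p dμ = −β·(∫ S e^{−βS} dμ)/Z(β) − log Z(β)`;
* §4 `μ = Haar^{⊗E}`: **`wilsonIdentityFlow_essFrac_partitionFunction`**,
  **`wilsonIdentityFlow_meanAccept_mem_Icc_partitionFunction`** (with `Z = (partitionFunction ρ ·).toReal`)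
  and **`wilsonIdentityFlow_forwardKL_haar`** (`= −β·⟨S⟩_β − log Z(β)` with theory-2's
  `wilsonExpectation`).

Reading (value-free; no number of ours is computed or implied): for every Wilson lattice gauge theory
the zero-training row of the S0/R1 boards is `ESS = Z(β)²/Z(2β)` with acceptance within `9/8` of it
below and `Z(β/2)²/Z(β)` above; the cell's exact 2-d oracles (`Σₖ I_{|k|}(β)^V` for U(1),
`(e^{−2β}/β)^V Σ_{n≥1} I_n(2β)^V` for SU(2)) turn these into Bessel closed forms.
NOT CLAIMED: any value at the cell's `(β, L)`; `d = 4` closed forms (none exist); nothing re-scored.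
-/

noncomputable section

namespace Summit.Ventures.LatticeQCDFlow.Theory2

open MeasureTheory Real
open Literature.MathematicalPhysics.QuantumFieldTheory

variable {d L N : ℕ} [NeZero L] {G : Type*} [Group G] [TopologicalSpace G] [IsTopologicalGroup G]
  [CompactSpace G] [MeasurableSpace G] [BorelSpace G] (ρ : G →* Matrix (Fin N) (Fin N) ℂ)
  (μ : Measure (GaugeConfig d L G)) [IsProbabilityMeasure μ]

/-! ## §1 The Boltzmann factor under doubling / halving the coupling; normalisation -/

omit [TopologicalSpace G] [IsTopologicalGroup G] [CompactSpace G] [MeasurableSpace G]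
  [BorelSpace G] in
/-- `(e^{−βS})² = e^{−2βS}`. [folklore] -/
theorem exp_neg_mul_wilsonAction_sq (β : ℝ) (U : GaugeConfig d L G) :
    Real.exp (-β * wilsonAction ρ U) ^ 2 = Real.exp (-(2 * β) * wilsonAction ρ U) := by
  rw [sq, ← Real.exp_add]
  ring_nf

omit [TopologicalSpace G] [IsTopologicalGroup G] [CompactSpace G] [MeasurableSpace G]
  [BorelSpace G] in
/-- `√(e^{−βS}) = e^{−(β/2)S}`. [folklore] -/
theorem sqrt_exp_neg_mul_wilsonAction (β : ℝ) (U : GaugeConfig d L G) :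
    Real.sqrt (Real.exp (-β * wilsonAction ρ U)) = Real.exp (-(β / 2) * wilsonAction ρ U) := by
  rw [← Real.exp_half]
  ring_nf

/-- `Z_μ(β) = ∫ e^{−βS} dμ > 0` for every reference probability law `μ`. [folklore] -/
theorem wilsonZI_pos (hρ : Continuous ρ) (β : ℝ) :
    0 < ∫ U, Real.exp (-β * wilsonAction ρ U) ∂μ :=
  integral_exp_pos (integrable_exp_mul_wilsonAction ρ hρ (-β) μ)

/-- The tilted density `p = e^{−βS}/Z_μ(β)` integrates to one. [folklore] -/
theorem integral_wilsonD (hρ : Continuous ρ) (β : ℝ) :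
    ∫ U, Real.exp (-β * wilsonAction ρ U) / ∫ V, Real.exp (-β * wilsonAction ρ V) ∂μ ∂μ = 1 := by
  rw [integral_div, div_self (wilsonZI_pos ρ μ hρ β).ne']

omit [CompactSpace G] [IsProbabilityMeasure μ] in
/-- The tilted density is measurable. [folklore] -/
theorem measurable_wilsonD (hρ : Continuous ρ) (β Z : ℝ) :
    Measurable fun U : GaugeConfig d L G => Real.exp (-β * wilsonAction ρ U) / Z :=
  (Real.measurable_exp.comp ((WilsonRP.measurable_wilsonAction ρ hρ).const_mul _)).div_const _

/-- The tilted density is integrable. [folklore] -/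
theorem integrable_wilsonD (hρ : Continuous ρ) (β Z : ℝ) :
    Integrable (fun U : GaugeConfig d L G => Real.exp (-β * wilsonAction ρ U) / Z) μ :=
  (integrable_exp_mul_wilsonAction ρ hρ (-β) _).div_const _

/-! ## §2 ESS, Bhattacharyya affinity and the acceptance sandwich -/

omit [TopologicalSpace G] [IsTopologicalGroup G] [CompactSpace G] [BorelSpace G]
  [IsProbabilityMeasure μ] in
/-- **`∫ p² dμ = Z(2β)/Z(β)²`.** [ours] -/
theorem integral_wilsonD_sq (β : ℝ) :
    ∫ U, (Real.exp (-β * wilsonAction ρ U) / ∫ V, Real.exp (-β * wilsonAction ρ V) ∂μ) ^ 2 ∂μ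
      = (∫ U, Real.exp (-(2 * β) * wilsonAction ρ U) ∂μ)
          / (∫ V, Real.exp (-β * wilsonAction ρ V) ∂μ) ^ 2 := by
  simp_rw [div_pow, exp_neg_mul_wilsonAction_sq]
  rw [integral_div]

/-- **`ESS = Z(β)²/Z(2β)` EXACTLY** — the effective-sample-size fraction `(∫p)²/∫p²` of `μ`-proposals
against the Boltzmann tilt `e^{−βS}μ`, for every compact gauge group, representation, dimension,
volume and reference law `μ` (`μ = Haar^{⊗E}`: the untrained flow of the cell). [ours] -/
theorem wilsonIdentityFlow_essFrac (hρ : Continuous ρ) (β : ℝ) :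
    (∫ U, Real.exp (-β * wilsonAction ρ U) / ∫ V, Real.exp (-β * wilsonAction ρ V) ∂μ ∂μ) ^ 2
        / ∫ U, (Real.exp (-β * wilsonAction ρ U) / ∫ V, Real.exp (-β * wilsonAction ρ V) ∂μ) ^ 2 ∂μ
      = (∫ V, Real.exp (-β * wilsonAction ρ V) ∂μ) ^ 2
          / ∫ U, Real.exp (-(2 * β) * wilsonAction ρ U) ∂μ := by
  rw [integral_wilsonD ρ μ hρ, integral_wilsonD_sq ρ μ, one_pow, one_div, inv_div]

/-- **The Bhattacharyya affinity `∫ √p dμ = Z(β/2)/√Z(β)`.** [ours] -/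
theorem integral_sqrt_wilsonD (hρ : Continuous ρ) (β : ℝ) :
    ∫ U, Real.sqrt (Real.exp (-β * wilsonAction ρ U) / ∫ V, Real.exp (-β * wilsonAction ρ V) ∂μ) ∂μ
      = (∫ U, Real.exp (-(β / 2) * wilsonAction ρ U) ∂μ)
          / Real.sqrt (∫ V, Real.exp (-β * wilsonAction ρ V) ∂μ) := by
  simp_rw [Real.sqrt_div' _ (wilsonZI_pos ρ μ hρ β).le, sqrt_exp_neg_mul_wilsonAction]
  rw [integral_div]

/-- **THE IDENTITY-FLOW ACCEPTANCE SANDWICH for Wilson lattice gauge theory**: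
`(8/9)·Z(β)²/Z(2β) ≤ ∫∫ min(p(U), p(U′)) dμ dμ ≤ Z(β/2)²/Z(β)` — the equilibrium acceptance of the
exact sampler proposing configurations from `μ` against `e^{−βS}μ`, for every compact `G`, continuous
`ρ`, `d`, `L`, `β` and reference probability law `μ`. [ours] -/
theorem wilsonIdentityFlow_meanAccept_mem_Icc (hρ : Continuous ρ) (β : ℝ) :
    ∫ U, ∫ U', min (Real.exp (-β * wilsonAction ρ U) / ∫ V, Real.exp (-β * wilsonAction ρ V) ∂μ)
        (Real.exp (-β * wilsonAction ρ U') / ∫ V, Real.exp (-β * wilsonAction ρ V) ∂μ) ∂μ ∂μ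
      ∈ Set.Icc (8 / 9 * ((∫ V, Real.exp (-β * wilsonAction ρ V) ∂μ) ^ 2
            / ∫ U, Real.exp (-(2 * β) * wilsonAction ρ U) ∂μ))
          ((∫ U, Real.exp (-(β / 2) * wilsonAction ρ U) ∂μ) ^ 2
            / ∫ V, Real.exp (-β * wilsonAction ρ V) ∂μ) := by
  set Z : ℝ := ∫ V, Real.exp (-β * wilsonAction ρ V) ∂μ with hZdef
  have hZ : 0 < Z := wilsonZI_pos ρ μ hρ β
  have hw0 : ∀ U : GaugeConfig d L G, 0 < Real.exp (-β * wilsonAction ρ U) := fun U => Real.exp_pos _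
  have hwm : Measurable fun U : GaugeConfig d L G => Real.exp (-β * wilsonAction ρ U) :=
    Real.measurable_exp.comp ((WilsonRP.measurable_wilsonAction ρ hρ).const_mul _)
  have hwi : Integrable (fun U : GaugeConfig d L G => Real.exp (-β * wilsonAction ρ U)) μ :=
    integrable_exp_mul_wilsonAction ρ hρ (-β) _
  have hq0 : ∀ _U : GaugeConfig d L G, (0 : ℝ) < 1 := fun _ => one_pos
  have hqm : Measurable fun _ : GaugeConfig d L G => (1 : ℝ) := measurable_const
  have hqi : Integrable (fun _ : GaugeConfig d L G => (1 : ℝ)) μ := integrable_const _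
  have hq1 : ∫ _U, (1 : ℝ) ∂μ = 1 := by rw [integral_const, probReal_univ, one_smul]
  constructor
  · -- floor: the general-space 8/9 law with `w = e^{−βS}`, `q = 1`
    have hW₂ : Integrable (fun U : GaugeConfig d L G =>
        Real.exp (-β * wilsonAction ρ U) / 1 * Real.exp (-β * wilsonAction ρ U)) μ := by
      simp_rw [div_one, ← sq, exp_neg_mul_wilsonAction_sq]
      exact integrable_exp_mul_wilsonAction ρ hρ _ _
    have hW₂val : ∫ U, Real.exp (-β * wilsonAction ρ U) / 1 * Real.exp (-β * wilsonAction ρ U) ∂μ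
        = ∫ U, Real.exp (-(2 * β) * wilsonAction ρ U) ∂μ := by
      simp_rw [div_one, ← sq, exp_neg_mul_wilsonAction_sq]
    have h := meanAccept_overlapForm_ge_eight_ninths_ESS (μ := μ) hw0 hwm hwi hq0 hqm hqi hq1 hW₂
    rw [hW₂val] at h
    simp_rw [mul_one] at h
    calc 8 / 9 * (Z ^ 2 / ∫ U, Real.exp (-(2 * β) * wilsonAction ρ U) ∂μ)
        = 8 * Z ^ 2 / (9 * ∫ U, Real.exp (-(2 * β) * wilsonAction ρ U) ∂μ) := by ring
      _ ≤ _ := h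
  · -- ceiling: the Bhattacharyya law
    have h := meanAccept_le_sq_integral_sqrt (μ := μ) (fun U => (div_pos (hw0 U) hZ).le)
      (measurable_wilsonD ρ hρ β Z) (integrable_wilsonD ρ μ hρ β Z) (fun U => (hq0 U).le) hqm hqi
    simp_rw [mul_one] at h
    rw [integral_sqrt_wilsonD ρ μ hρ, div_pow, Real.sq_sqrt hZ.le] at h
    exact h

/-! ## §3 The two Kullback–Leibler divergences at zero training -/

/-- **REVERSE KL**: `D(μ ‖ e^{−βS}μ/Z) = ∫ log(1/p) dμ = log Z(β) + β·∫ S dμ`. [ours] -/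
theorem wilsonIdentityFlow_reverseKL (hρ : Continuous ρ) (β : ℝ) :
    ∫ U, Real.log (1 / (Real.exp (-β * wilsonAction ρ U)
        / ∫ V, Real.exp (-β * wilsonAction ρ V) ∂μ)) ∂μ
      = Real.log (∫ V, Real.exp (-β * wilsonAction ρ V) ∂μ) + β * ∫ U, wilsonAction ρ U ∂μ := by
  have hZ : 0 < ∫ V, Real.exp (-β * wilsonAction ρ V) ∂μ := wilsonZI_pos ρ μ hρ β
  have e : ∀ U : GaugeConfig d L G, Real.log (1 / (Real.exp (-β * wilsonAction ρ U)
        / ∫ V, Real.exp (-β * wilsonAction ρ V) ∂μ))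
      = Real.log (∫ V, Real.exp (-β * wilsonAction ρ V) ∂μ) + β * wilsonAction ρ U := by
    intro U
    rw [one_div, inv_div, Real.log_div hZ.ne' (Real.exp_pos _).ne', Real.log_exp]
    ring
  simp_rw [e]
  rw [integral_add (integrable_const _) ((integrable_wilsonAction ρ hρ _).const_mul β),
    integral_const, probReal_univ, one_smul, integral_const_mul]

/-- `S·e^{−βS}` is integrable (bounded action, continuous `ρ`). [folklore] -/
theorem integrable_wilsonAction_mul_exp (hρ : Continuous ρ) (β : ℝ) :
    Integrable (fun U : GaugeConfig d L G =>
      wilsonAction ρ U * Real.exp (-β * wilsonAction ρ U)) μ := by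
  obtain ⟨B, hB⟩ := exists_abs_wilsonAction_le (d := d) (L := L) ρ hρ
  refine ((integrable_exp_mul_wilsonAction ρ hρ (-β) _).const_mul B).mono'
    ((WilsonRP.measurable_wilsonAction ρ hρ).mul (Real.measurable_exp.comp
      ((WilsonRP.measurable_wilsonAction ρ hρ).const_mul _))).aestronglyMeasurable
    (ae_of_all _ fun U => ?_)
  rw [Real.norm_eq_abs, abs_mul, Real.abs_exp]
  exact mul_le_mul_of_nonneg_right (hB U) (Real.exp_pos _).le

/-- **FORWARD KL**: `D(e^{−βS}μ/Z ‖ μ) = ∫ p log p dμ = −β·(∫ S e^{−βS} dμ)/Z(β) − log Z(β)` (the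
tilted mean of the action). [ours] -/
theorem wilsonIdentityFlow_forwardKL (hρ : Continuous ρ) (β : ℝ) :
    ∫ U, (Real.exp (-β * wilsonAction ρ U) / ∫ V, Real.exp (-β * wilsonAction ρ V) ∂μ)
        * Real.log (Real.exp (-β * wilsonAction ρ U)
          / ∫ V, Real.exp (-β * wilsonAction ρ V) ∂μ) ∂μ
      = -β * ((∫ U, wilsonAction ρ U * Real.exp (-β * wilsonAction ρ U) ∂μ)
            / ∫ V, Real.exp (-β * wilsonAction ρ V) ∂μ)
          - Real.log (∫ V, Real.exp (-β * wilsonAction ρ V) ∂μ) := by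
  set Z : ℝ := ∫ V, Real.exp (-β * wilsonAction ρ V) ∂μ with hZdef
  have hZ : 0 < Z := wilsonZI_pos ρ μ hρ β
  have e : ∀ U : GaugeConfig d L G, (Real.exp (-β * wilsonAction ρ U) / Z)
        * Real.log (Real.exp (-β * wilsonAction ρ U) / Z)
      = -β * (1 / Z) * (wilsonAction ρ U * Real.exp (-β * wilsonAction ρ U))
          - Real.log Z * (Real.exp (-β * wilsonAction ρ U) / Z) := by
    intro U
    rw [Real.log_div (Real.exp_pos _).ne' hZ.ne', Real.log_exp]
    ring
  simp_rw [e]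
  rw [integral_sub ((integrable_wilsonAction_mul_exp ρ μ hρ β).const_mul _)
      ((integrable_wilsonD ρ μ hρ β Z).const_mul _), integral_const_mul, integral_const_mul, hZdef,
    integral_wilsonD ρ μ hρ β, mul_one]
  field_simp

/-! ## §4 The product Haar reference law: theory-2's `partitionFunction` and `wilsonExpectation` -/

/-- **`ESS = Z(β)²/Z(2β)`** for the identity flow (`μ = Haar^{⊗E}`), `Z = (partitionFunction ρ ·).toReal`.
[ours] -/
theorem wilsonIdentityFlow_essFrac_partitionFunction (hρ : Continuous ρ) (β : ℝ) :
    (∫ U, Real.exp (-β * wilsonAction ρ U) / ∫ V, Real.exp (-β * wilsonAction ρ V)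
          ∂(Measure.pi fun _ : Edge d L => haarProbability G)
        ∂(Measure.pi fun _ : Edge d L => haarProbability G)) ^ 2
        / ∫ U, (Real.exp (-β * wilsonAction ρ U) / ∫ V, Real.exp (-β * wilsonAction ρ V)
            ∂(Measure.pi fun _ : Edge d L => haarProbability G)) ^ 2
          ∂(Measure.pi fun _ : Edge d L => haarProbability G)
      = (partitionFunction (d := d) (L := L) ρ β).toReal ^ 2
          / (partitionFunction (d := d) (L := L) ρ (2 * β)).toReal := by
  rw [wilsonIdentityFlow_essFrac ρ _ hρ, partitionFunction_toReal_eq_integral ρ hρ,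
    partitionFunction_toReal_eq_integral ρ hρ]

/-- **`(8/9)·Z(β)²/Z(2β) ≤ acc ≤ Z(β/2)²/Z(β)`** for the identity flow (`μ = Haar^{⊗E}`),
`Z = (partitionFunction ρ ·).toReal`. [ours] -/
theorem wilsonIdentityFlow_meanAccept_mem_Icc_partitionFunction (hρ : Continuous ρ) (β : ℝ) :
    ∫ U, ∫ U', min (Real.exp (-β * wilsonAction ρ U) / ∫ V, Real.exp (-β * wilsonAction ρ V)
            ∂(Measure.pi fun _ : Edge d L => haarProbability G))
        (Real.exp (-β * wilsonAction ρ U') / ∫ V, Real.exp (-β * wilsonAction ρ V)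
            ∂(Measure.pi fun _ : Edge d L => haarProbability G))
        ∂(Measure.pi fun _ : Edge d L => haarProbability G)
        ∂(Measure.pi fun _ : Edge d L => haarProbability G)
      ∈ Set.Icc (8 / 9 * ((partitionFunction (d := d) (L := L) ρ β).toReal ^ 2
            / (partitionFunction (d := d) (L := L) ρ (2 * β)).toReal))
          ((partitionFunction (d := d) (L := L) ρ (β / 2)).toReal ^ 2
            / (partitionFunction (d := d) (L := L) ρ β).toReal) := by
  rw [partitionFunction_toReal_eq_integral ρ hρ, partitionFunction_toReal_eq_integral ρ hρ,
    partitionFunction_toReal_eq_integral ρ hρ]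
  exact wilsonIdentityFlow_meanAccept_mem_Icc ρ _ hρ β

/-- **FORWARD KL of the identity flow** (`μ = Haar^{⊗E}`): `∫ p log p = −β·⟨S⟩_β − log Z(β)` with
theory-2's Wilson expectation `⟨S⟩_β = wilsonExpectation ρ β S`. [ours] -/
theorem wilsonIdentityFlow_forwardKL_haar (hρ : Continuous ρ) (β : ℝ) :
    ∫ U, (Real.exp (-β * wilsonAction ρ U) / ∫ V, Real.exp (-β * wilsonAction ρ V)
            ∂(Measure.pi fun _ : Edge d L => haarProbability G))
        * Real.log (Real.exp (-β * wilsonAction ρ U) / ∫ V, Real.exp (-β * wilsonAction ρ V)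
            ∂(Measure.pi fun _ : Edge d L => haarProbability G))
        ∂(Measure.pi fun _ : Edge d L => haarProbability G)
      = -β * wilsonExpectation ρ β (wilsonAction (d := d) (L := L) ρ)
          - Real.log (partitionFunction (d := d) (L := L) ρ β).toReal := by
  rw [wilsonIdentityFlow_forwardKL ρ _ hρ, wilsonExpectation_eq_integral_div ρ hρ β,
    partitionFunction_toReal_eq_integral ρ hρ]

end Summit.Ventures.LatticeQCDFlow.Theory2

end
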